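import Literature.MathematicalPhysics.QuantumFieldTheory.Balaban1985CMP102.Setting
import Summits.QuantumFields.Balaban3D.Proofs.GroupModelEq32

/-!
# `Summit.QuantumFields.Balaban3D.Proofs.GroupModelSkew` — matrix calculus for the lane's group model: `𝔤 ⊂ 𝔲(N)`,
# `Ad(G)𝔤 ⊆ 𝔤`, `𝔤ᶜ = 𝔤 ⊕ i𝔤` inside `M_N(ℂ)`, and the VECTOR FORM of «the only element invariant is 0» ([Balaban1985UV3]
# p. 264 L6–7) for the complexification `𝔤ᶜ` — lane `pub-balaban3d`, seat p4 (ruling R-32; companion of `…Proofs.GroupModelLieC`)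

HONEST FRAMING (lane PLAN.md §0, binding): see `…Proofs.SectAFirstStep`.  Nothing of [Balaban1985UV3] beyond the quoted
Lie-algebra sentence of p. 264 is touched; NOT a construction of 𝒫′₁ or of the charts (29).

WHAT IS PRINTED.  p. 264 = PDF 10 L4–12 (render `…/1985-cmp102-uv-stability-3d/…-p010-x2.png`): «The gauge invariance (26)
implies the invariance with respect to the global transformations R(U), U ∈ G, hence the equality (31) … The derivative in
the above formula is an element of the Lie algebra 𝔤, and by the assumption that 𝔤 is semi-simple, the only element invariant
is 0, and we conclude (32) … It is the only place we use the semi-simplicity».  The chart variables of (27)–(29) p. 263 are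
𝔤ᶜ-valued («𝓗(B) … with values in 𝔤ᶜ»), so seat p6 reads (31) ⇒ (32) for COMPLEX-linear derivatives on 𝔤ᶜ; this file carries
the printed sentence from 𝔤 (seat p4's `GroupModelEq32.eq32_of_eq31_conj`) to 𝔤ᶜ.

WHAT THIS FILE PROVES (no `sorry`, axioms standard), for `M : Setting.GroupModel G` (faithful unitary realisation
`ρ : G →* M_N(ℂ)` with closed range, `𝔤 = M.lie = {X : exp tX ∈ ρ(G) ∀ t}`, `M.semisimple`):
* `add_eq_zero_of_forall_exp_mul_exp` [folklore] — `exp(tY)exp(tX) = 1 ∀ t ⇒ Y + X = 0` (derivative at 0);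
* `conjTranspose_eq_neg_of_mem_lie` — **𝔤 ⊂ 𝔲(N)**: `X ∈ 𝔤 ⇒ Xᴴ = −X` ([4] p. 18 L22–23 «a Lie subgroup G of a unitary group
  U(N)»; `exp(tX)ᴴexp(tX) = 1`);
* `rho_inv_eq_star`, `conj_mem_lie` — `ρ(U⁻¹) = ρ(U)ᴴ` and **`Ad(ρ U)𝔤 ⊆ 𝔤`** (`exp(U(tX)U⁻¹) = U exp(tX) U⁻¹`, Mathlib
  `Matrix.exp_units_conj`);
* `exists_decomp_of_mem_span`, `decomp_unique` — **`span_ℂ 𝔤 = 𝔤 ⊕ i𝔤`** (existence by span induction; uniqueness because 𝔤 is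
  skew-Hermitian and i𝔤 Hermitian);
* `eq_zero_of_mem_span_of_conj_eq` — **no `Ad(G)`-fixed vector in 𝔤ᶜ**: `v ∈ span_ℂ 𝔤`, `ρ(U)vρ(U)ᴴ = v ∀ U ⇒ v = 0` (both
  components are `Ad(G)`-fixed elements of 𝔤, hence 0 by `eq32_of_eq31_conj` = real semisimplicity).  No hypothesis that 𝔤ᶜ is
  complex-semisimple is used.
-/

noncomputable section

namespace Summit.QuantumFields.Balaban3D.Proofs.GroupModelSkew

open Literature.MathematicalPhysics.QuantumFieldTheory.Balaban1983to89
open Literature.MathematicalPhysics.QuantumFieldTheory.Balaban1985CMP102.Setting (GroupModel)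
open scoped Matrix.Norms.L2Operator ComplexConjugate

variable {G : Type} [GaugeGroup G] [MeasurableSpace G] (M : GroupModel G)

/-- [folklore] calculus: if `exp(tY)·exp(tX) = 1` for all real `t`, then `Y + X = 0` (derivative at `t = 0`; Mathlib
`hasDerivAt_exp_smul_const`, composed with `ℝ → ℂ`). [folklore] -/
theorem add_eq_zero_of_forall_exp_mul_exp {N : ℕ} (Y X : Matrix (Fin N) (Fin N) ℂ)
    (h : ∀ t : ℝ, NormedSpace.exp ((t : ℂ) • Y) * NormedSpace.exp ((t : ℂ) • X) = 1) : Y + X = 0 := by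
  have hof : HasDerivAt (fun t : ℝ => (t : ℂ)) 1 0 := by
    have h0 : HasDerivAt (⇑Complex.ofRealCLM) (Complex.ofRealCLM 1) (0 : ℝ) := Complex.ofRealCLM.hasDerivAt
    rw [Complex.ofRealCLM_apply, Complex.ofReal_one] at h0
    exact h0.congr_of_eventuallyEq (Filter.Eventually.of_forall fun t => (Complex.ofRealCLM_apply t).symm)
  have hder : ∀ Z : Matrix (Fin N) (Fin N) ℂ,
      HasDerivAt (fun t : ℝ => NormedSpace.exp ((t : ℂ) • Z)) Z 0 := fun Z => by
    have hF : HasDerivAt ((fun u : ℂ => NormedSpace.exp (u • Z)) ∘ fun t : ℝ => (t : ℂ))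
        ((1 : ℂ) • (NormedSpace.exp (((0 : ℝ) : ℂ) • Z) * Z)) 0 :=
      (hasDerivAt_exp_smul_const Z ((0 : ℝ) : ℂ)).scomp (0 : ℝ) hof
    rw [Complex.ofReal_zero, zero_smul, NormedSpace.exp_zero, one_mul, one_smul] at hF
    exact hF
  have hprod := (hder Y).mul (hder X)
  simp only [Complex.ofReal_zero, zero_smul, NormedSpace.exp_zero, one_mul, mul_one] at hprod
  have hconst : HasDerivAt (fun _ : ℝ => (1 : Matrix (Fin N) (Fin N) ℂ)) (Y + X) 0 := by
    refine hprod.congr_of_eventuallyEq (Filter.Eventually.of_forall fun t => ?_)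
    exact (h t).symm
  exact hconst.unique (hasDerivAt_const (0 : ℝ) (1 : Matrix (Fin N) (Fin N) ℂ))

/-- **`𝔤 ⊂ 𝔲(N)`**: every `X ∈ 𝔤` is skew-Hermitian, `Xᴴ = −X` — because `exp(tX) ∈ ρ(G) ⊂ U(N)` for all real `t`
(`GroupModel.mem_lie_iff`, `GroupModel.mem_unitary`), so `exp(tXᴴ)exp(tX) = exp(tX)ᴴexp(tX) = 1`, and §2's calculus lemma
gives `Xᴴ + X = 0`.  [4] = [Balaban1985Averaging] p. 18 L22–23 «values in a Lie subgroup G of a unitary group U(N)».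
[folklore] -/
theorem conjTranspose_eq_neg_of_mem_lie {X : Matrix (Fin M.N) (Fin M.N) ℂ} (hX : X ∈ M.lie) :
    X.conjTranspose = -X := by
  have hexp : ∀ t : ℝ, NormedSpace.exp ((t : ℂ) • X.conjTranspose) * NormedSpace.exp ((t : ℂ) • X) = 1 := by
    intro t
    obtain ⟨U, hU⟩ := (M.mem_lie_iff X).mp hX t
    have hunit : NormedSpace.exp ((t : ℂ) • X) ∈ Matrix.unitaryGroup (Fin M.N) ℂ := by
      rw [← hU]; exact M.mem_unitary U
    have hstar : star (NormedSpace.exp ((t : ℂ) • X)) = NormedSpace.exp ((t : ℂ) • X.conjTranspose) := by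
      rw [NormedSpace.star_exp, star_smul, Matrix.star_eq_conjTranspose, Complex.star_def, Complex.conj_ofReal]
    rw [← hstar]
    exact Matrix.mem_unitaryGroup_iff'.mp hunit
  have := add_eq_zero_of_forall_exp_mul_exp _ _ hexp
  exact eq_neg_of_add_eq_zero_left this

/-- For the unitary matrix `ρ(U)`: `ρ(U)ᴴ = ρ(U⁻¹)` and `ρ(U) ρ(U)ᴴ = 1 = ρ(U)ᴴ ρ(U)`. [folklore] -/
theorem rho_inv_eq_star (U : G) : M.ρ U⁻¹ = star (M.ρ U) := by
  have h1 : M.ρ U⁻¹ * M.ρ U = 1 := by rw [← map_mul, inv_mul_cancel, map_one]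
  have h2 : star (M.ρ U) * M.ρ U = 1 := Matrix.mem_unitaryGroup_iff'.mp (M.mem_unitary U)
  calc M.ρ U⁻¹ = M.ρ U⁻¹ * (M.ρ U * star (M.ρ U)) := by
        rw [Matrix.mem_unitaryGroup_iff.mp (M.mem_unitary U), mul_one]
    _ = (M.ρ U⁻¹ * M.ρ U) * star (M.ρ U) := by rw [mul_assoc]
    _ = star (M.ρ U) := by rw [h1, one_mul]

/-- **`Ad(ρ U)𝔤 ⊆ 𝔤`**: for `X ∈ 𝔤` and `U ∈ G`, `ρ(U) X ρ(U)ᴴ ∈ 𝔤` — since `exp(t·ρ(U)Xρ(U)⁻¹) = ρ(U) exp(tX) ρ(U)⁻¹ =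
ρ(U g_t U⁻¹) ∈ ρ(G)` (Mathlib `NormedSpace.exp_units_conj`, `GroupModel.mem_lie_iff`). [folklore] -/
theorem conj_mem_lie {X : Matrix (Fin M.N) (Fin M.N) ℂ} (hX : X ∈ M.lie) (U : G) :
    M.ρ U * X * star (M.ρ U) ∈ M.lie := by
  rw [M.mem_lie_iff]
  intro t
  obtain ⟨g, hg⟩ := (M.mem_lie_iff X).mp hX t
  let u : (Matrix (Fin M.N) (Fin M.N) ℂ)ˣ := Unitary.toUnits ⟨M.ρ U, M.mem_unitary U⟩
  have hu : (u : Matrix (Fin M.N) (Fin M.N) ℂ) = M.ρ U := rfl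
  have hui : ((u⁻¹ : (Matrix (Fin M.N) (Fin M.N) ℂ)ˣ) : Matrix (Fin M.N) (Fin M.N) ℂ) = star (M.ρ U) := rfl
  have hsmul : (t : ℂ) • (M.ρ U * X * star (M.ρ U))
      = (u : Matrix (Fin M.N) (Fin M.N) ℂ) * ((t : ℂ) • X) * ((u⁻¹ : (Matrix (Fin M.N) (Fin M.N) ℂ)ˣ) : Matrix _ _ ℂ) := by
    rw [hu, hui, Matrix.mul_smul, Matrix.smul_mul]
  rw [hsmul, Matrix.exp_units_conj, hu, hui, ← hg, ← rho_inv_eq_star, ← map_mul, ← map_mul]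
  exact ⟨U * g * U⁻¹, rfl⟩

/-- The real-linear combination `a·A + b·B` of elements of `𝔤` is in `𝔤` (𝔤 is a real subspace). [folklore] -/
theorem lincomb_mem_lie {A B : Matrix (Fin M.N) (Fin M.N) ℂ} (hA : A ∈ M.lie) (hB : B ∈ M.lie) (a b : ℝ) :
    (a : ℂ) • A + (b : ℂ) • B ∈ M.lie := by
  letI : LieRing (Matrix (Fin M.N) (Fin M.N) ℂ) := LieRing.ofAssociativeRing  -- the bracket of `…Setting` (proof-local)
  have ha : a • A = (a : ℂ) • A := RCLike.real_smul_eq_coe_smul (K := ℂ) a A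
  have hb : b • B = (b : ℂ) • B := RCLike.real_smul_eq_coe_smul (K := ℂ) b B
  rw [← ha, ← hb]
  exact M.lie.add_mem (M.lie.smul_mem a hA) (M.lie.smul_mem b hB)

/-- **`𝔤ᶜ = 𝔤 + i𝔤`**: every element of the complex span of `𝔤` in `M_N(ℂ)` is `A + i·B` with `A, B ∈ 𝔤`. [folklore] -/
theorem exists_decomp_of_mem_span {v : Matrix (Fin M.N) (Fin M.N) ℂ}
    (hv : v ∈ Submodule.span ℂ (M.lie : Set (Matrix (Fin M.N) (Fin M.N) ℂ))) :
    ∃ A ∈ M.lie, ∃ B ∈ M.lie, v = A + Complex.I • B := by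
  letI : LieRing (Matrix (Fin M.N) (Fin M.N) ℂ) := LieRing.ofAssociativeRing  -- the bracket of `…Setting` (proof-local)
  induction hv using Submodule.span_induction with
  | mem x hx => exact ⟨x, hx, 0, M.lie.zero_mem, by simp⟩
  | zero => exact ⟨0, M.lie.zero_mem, 0, M.lie.zero_mem, by simp⟩
  | add x y _ _ hx hy =>
      obtain ⟨A, hA, B, hB, rfl⟩ := hx
      obtain ⟨A', hA', B', hB', rfl⟩ := hy
      exact ⟨A + A', M.lie.add_mem hA hA', B + B', M.lie.add_mem hB hB', by
        simp only [smul_add]; abel⟩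
  | smul c x _ hx =>
      obtain ⟨A, hA, B, hB, rfl⟩ := hx
      refine ⟨(c.re : ℂ) • A + ((-c.im : ℝ) : ℂ) • B, lincomb_mem_lie M hA hB c.re (-c.im),
        (c.im : ℂ) • A + (c.re : ℂ) • B, lincomb_mem_lie M hA hB c.im c.re, ?_⟩
      have key : ∀ a b : ℂ, (a + b * Complex.I) • (A + Complex.I • B)
          = (a • A + (-b) • B) + Complex.I • (b • A + a • B) := by
        intro a b
        simp only [smul_add, add_smul, smul_smul, add_mul]
        rw [show b * Complex.I * Complex.I = -b by rw [mul_assoc, Complex.I_mul_I, mul_neg, mul_one],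
          mul_comm Complex.I b, mul_comm Complex.I a]
        abel
      have hc : c = (c.re : ℂ) + (c.im : ℂ) * Complex.I := (Complex.re_add_im c).symm
      conv_lhs => rw [hc]
      rw [Complex.ofReal_neg]
      exact key _ _

/-- **`𝔤 ∩ i𝔤 = 0`** (uniqueness of the decomposition): if `A + i·B = 0` with `A, B ∈ 𝔤` then `A = 0` and `B = 0` — apply
`ᴴ`: `−A + i·B = 0` (A, B skew-Hermitian), add and subtract. [folklore] -/
theorem decomp_unique {A B : Matrix (Fin M.N) (Fin M.N) ℂ} (hA : A ∈ M.lie) (hB : B ∈ M.lie)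
    (h : A + Complex.I • B = 0) : A = 0 ∧ B = 0 := by
  have hH : -A + Complex.I • B = 0 := by
    have := congrArg Matrix.conjTranspose h
    rw [Matrix.conjTranspose_add, Matrix.conjTranspose_smul, conjTranspose_eq_neg_of_mem_lie M hA,
      conjTranspose_eq_neg_of_mem_lie M hB, Matrix.conjTranspose_zero, Complex.star_def, Complex.conj_I,
      neg_smul, smul_neg, neg_neg] at this
    exact this
  have hA0 : A = 0 := by
    have h2 : (A + Complex.I • B) - (-A + Complex.I • B) = 0 := by rw [h, hH, sub_zero]
    have h3 : (2 : ℂ) • A = 0 := by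
      rw [two_smul]
      have : (A + Complex.I • B) - (-A + Complex.I • B) = A + A := by abel
      rwa [this] at h2
    exact (smul_eq_zero.mp h3).resolve_left two_ne_zero
  refine ⟨hA0, ?_⟩
  rw [hA0, zero_add] at h
  exact (smul_eq_zero.mp h).resolve_left Complex.I_ne_zero

/-- **No `Ad(G)`-fixed vector in `𝔤ᶜ`** (the VECTOR FORM of «the only element invariant is 0», p. 264 L6–7, for the
complexification): if `v ∈ span_ℂ 𝔤` and `ρ(U) v ρ(U)ᴴ = v` for all `U ∈ G`, then `v = 0`.  Write `v = A + iB`; `Ad(U)`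
preserves `𝔤` (`conj_mem_lie`) and the decomposition is unique (`decomp_unique`), so `A` and `B` are separately
`Ad(G)`-fixed elements of `𝔤`, hence `0` by seat p4's (31) ⇒ (32) `GroupModelEq32.eq32_of_eq31_conj` (real semisimplicity
of `𝔤`, `GroupModel.semisimple`). [cite: Balaban1985UV3, (31)–(32) p.264] -/
theorem eq_zero_of_mem_span_of_conj_eq {v : Matrix (Fin M.N) (Fin M.N) ℂ}
    (hv : v ∈ Submodule.span ℂ (M.lie : Set (Matrix (Fin M.N) (Fin M.N) ℂ)))
    (hfix : ∀ U : G, M.ρ U * v * star (M.ρ U) = v) : v = 0 := by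
  letI : LieRing (Matrix (Fin M.N) (Fin M.N) ℂ) := LieRing.ofAssociativeRing  -- the bracket of `…Setting` (proof-local)
  obtain ⟨A, hA, B, hB, rfl⟩ := exists_decomp_of_mem_span M hv
  have hsplit : ∀ U : G, M.ρ U * A * star (M.ρ U) = A ∧ M.ρ U * B * star (M.ρ U) = B := fun U => by
    have hU := hfix U
    have hdiff : (M.ρ U * A * star (M.ρ U) - A) + Complex.I • (M.ρ U * B * star (M.ρ U) - B) = 0 := by
      rw [smul_sub]
      have : M.ρ U * (A + Complex.I • B) * star (M.ρ U)
          = M.ρ U * A * star (M.ρ U) + Complex.I • (M.ρ U * B * star (M.ρ U)) := by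
        rw [mul_add, add_mul, Matrix.mul_smul, Matrix.smul_mul]
      rw [this] at hU
      have h' := sub_eq_zero.mpr hU
      have : M.ρ U * A * star (M.ρ U) + Complex.I • (M.ρ U * B * star (M.ρ U)) - (A + Complex.I • B)
          = M.ρ U * A * star (M.ρ U) - A + (Complex.I • (M.ρ U * B * star (M.ρ U)) - Complex.I • B) := by abel
      rwa [this] at h'
    have hmemA : M.ρ U * A * star (M.ρ U) - A ∈ M.lie := M.lie.sub_mem (conj_mem_lie M hA U) hA
    have hmemB : M.ρ U * B * star (M.ρ U) - B ∈ M.lie := M.lie.sub_mem (conj_mem_lie M hB U) hB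
    have ⟨h1, h2⟩ := decomp_unique M hmemA hmemB hdiff
    exact ⟨sub_eq_zero.mp h1, sub_eq_zero.mp h2⟩
  have hA0 : (⟨A, hA⟩ : M.lie) = 0 :=
    GroupModelEq32.eq32_of_eq31_conj M ⟨A, hA⟩ fun U => (hsplit U).1
  have hB0 : (⟨B, hB⟩ : M.lie) = 0 :=
    GroupModelEq32.eq32_of_eq31_conj M ⟨B, hB⟩ fun U => (hsplit U).2
  have hA0' : A = 0 := congrArg Subtype.val hA0
  have hB0' : B = 0 := congrArg Subtype.val hB0
  rw [hA0', hB0', smul_zero, add_zero]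

end Summit.QuantumFields.Balaban3D.Proofs.GroupModelSkew

end
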